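/-
Copyright (c) 2026 the pub-hodgecm-mathlib formalisation cell (harness21).  Prover seat hodgecm-mathlib-LH4-p06 (g0): unit U2H_HSide of the «(D-RAM) FOUR-FRAME» road,
TIER-2 «ROW-(1) REDUCTION IN DEPTH CURRENCY» for the rows socket (ρ) `stub_U2H_rowsR_hFamily_unit0` (U2H ED. 6).  2026-09-03.
-/
import Summits.HodgeConjecture.HodgeConjecture.Theorems.F0P3cDyRamRowOneReduction               -- ★ p855299 `rowOne_of_hSideIdentity` (+ ★ «Δ» slot lemma, ★ «T∕P», ★ «E»)
import Literature.NumberTheory.Rogawski1990.UnitaryLatticeTreeTameRamifiedCM                 -- ★ `natCard_valuedResidueField_eq_of_ramified_CM` (`#k_w = #k_v` at a ramified place, `Valued` presentation)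
import HarnessLib

/-!
# Crux `H413`, line LH4 «(D-RAM) FOUR-FRAME» road — unit U2H_HSide (ii-H), TIER 2: THE ROW-(1) REDUCTION IN DEPTH CURRENCY — ROW (1) of (D-H)-S for a family `(ψ, coef)`
# FOLLOWS from `Σ_s coef_s·Φ^st(γ_H, ψ_s) = C · 4·(q_w^{j} − q_w^{s})⁺ ∕ (q_w − 1)`, `j = (n₃ + 2 − d)∕2`, `s = shift d t_E [− τ d off t = 0]` — a function of the DEPTH `n₃` of `g` ALONE

Cell `hodgecm-mathlib` (D-0151), FLOOR 0, crux item H413 = `stmt-HodgeConjecture-24833`, route of record `HCCMUnconditional`; squad F0∕P3c∕LH4; tier-1 module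
`Cruxes/H413/Lines/F0_P3c_DyRamFourFrame_U2H_HSide.lean` ED. 6 ((ρ) `stub_U2H_rowsR_hFamily_unit0`), seat LH4-p06 (g0).  THEOREMS ONLY (no `def`, no instance, no notation,
no `sorry`, no named fact, default heartbeats); lane `--supports stmt-HodgeConjecture-24833` (count-neutral).

WHAT IS PROVED.  ★ p855299 `rowOne_of_hSideIdentity` reduces ROW (1) to the H-side identity with right-hand side `C · q_v^{−(n₁+n₂)∕2} · ampl(q_w, k, B′)` — still carrying the
G-side book-keeping `n₁, n₂, k, B, i` and the residue cardinal `q_v` of `L⁺_v`.  Here all of it is DISCHARGED: the slot is `i = 2` (★ slot lemma — so `2B = n₃ − d + 2 − 2·shift d t_E`),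
`2k + d = n₁ + n₂ + n₃ + 2` and `n₁ + n₂ = 2m` (★ «T∕P») give `k − m = (n₃ + 2 − d)∕2 =: j` and `k − m − B′ = shift d t_E − [τ d]_{t ≠ 0}`, `q_v = q_w` at a ramified place (★
`natCard_valuedResidueField_eq_of_ramified_CM`), and `q^{−m}·ampl(q, k, B′) = 4·(q^{j} − q^{j − B′})⁺∕(q − 1)` (§1, `zpow` algebra in ℚ).  HEAD **`rowOne_of_hSideIdentity_depth`**: IF near `1`,
on the row-(1) data, `Σ_s coef_s·Φ^st(γ_H, ψ_s) = C · 4·(q_w^{(n₃+2−d)∕2} − q_w^{shift d t_E − [τ d]_{t≠0}})⁺ ∕ (q_w − 1)` (ℤ exponents, exact: `n₃ + 2 − d` is even on the datum and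
`j − B′ = shift d t_E − [τ d]_{t≠0}`), THEN ROW (1) holds VERBATIM.  For (ρ) (`t = 0`, `shift = shiftR`, `shiftR d t_E = d − d mod 2`): the target of child (b′) is
  `Σ_s coef_s·Φ^st(γ_H, hFamily s) = C · 4·(q_w^{(n₃+2−d)∕2} − q_w^{d − d mod 2})⁺ ∕ (q_w − 1)` — the depth `n₃ = ord_w(a² − b²)` of `g` (= #4's `N`) and `d` ONLY.

HONEST LABEL.  Count-neutral; nothing printed is asserted; `HC_CM` is proved only modulo the 7 printed citations (2 remaining: hLiu418 = `stmt-HodgeConjecture-24832`, h413 =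
`stmt-HodgeConjecture-24833`) until rung 0 closes.

## References
* [Rogawski1990] J. D. Rogawski, *Automorphic Representations of Unitary Groups in Three Variables*, Ann. of Math. Stud. 123 (1990): §4.9 Prop. 4.9.1 (a)(b) p. 55,
  Lemma 4.9.3 (4.9.2) p. 56.
* [LabesseLanglands1979] J.-P. Labesse, R. P. Langlands, *L-indistinguishability for SL(2)*, Canad. J. Math. 31 (1979): §2 (2.2) (`δ_m = 2q^m`).
* [NeukirchANT1999] J. Neukirch, *Algebraic Number Theory* (1999): Ch. II §4 Prop. (4.3) (`f(w|v) = 1` at a ramified place of a quadratic extension).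
-/

set_option autoImplicit false

noncomputable section

namespace Summit.HodgeConjecture.HodgeConjecture.Cruxes.H413.F0P3cDyRamRowOneReductionDepth

open MeasureTheory Measure NumberField IsDedekindDomain Topology Filter
open Literature.NumberTheory.Automorphic Literature.NumberTheory.Automorphic.UnitaryGroup Literature.NumberTheory.Automorphic.IntegralReduction
open Literature.NumberTheory.Automorphic.UnitaryLatticeTree Literature.NumberTheory.Automorphic.HermitianLattice
open Literature.NumberTheory.Rogawski1990 Literature.NumberTheory.GaloisRepresentations
open Literature.MeasureTheory.Group (descConj)
open Literature.NumberTheory.Automorphic.UnitaryThreeFourFrame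
open Summit.HodgeConjecture.HodgeConjecture.Cruxes.H413.F0P3cDyRamFourFrameHSideDefs
open Summit.HodgeConjecture.HodgeConjecture.Cruxes.H413.F0P3cDyRamFourFrameHSideDefsR
open Summit.HodgeConjecture.HodgeConjecture.Cruxes.H413.F0P3cDyRamRowOneDeltaBaseValue
open Summit.HodgeConjecture.HodgeConjecture.Cruxes.H413.F0P3cDyRamRowOneDepthToken
open Summit.HodgeConjecture.HodgeConjecture.Cruxes.H413.F0P3cDyRamRowOneReduction
open scoped Matrix MatrixGroups Classical ValuativeRel WithZero

/-! ## §1 The `ampl` token with the `D`-factor absorbed: `q^{−m}·ampl(q, k, B) = 4·(q^{k−m} − q^{k−m−B})⁺∕(q − 1)` (ℤ exponents) -/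

/-- **`(q^m)⁻¹ · ampl(q, k, B) = 4·(q^{j} − q^{j−B})⁺ ∕ (q − 1)`** for `j = k − m ∈ ℤ` (`q ≠ 0`; ★ #0a H11 `ampl q k B = 4·(q^k − q^{k−B})⁺∕(q − 1)`). [cite: LabesseLanglands1979, §2 (2.2)] -/
theorem inv_pow_mul_ampl_eq (q : ℕ) (hq : q ≠ 0) (m k : ℕ) (B j : ℤ) (hj : j = (k : ℤ) - m) :
    ((q : ℚ) ^ m)⁻¹ * ampl q k B = 4 * max 0 ((q : ℚ) ^ j - (q : ℚ) ^ (j - B)) / ((q : ℚ) - 1) := by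
  have hq0 : (q : ℚ) ≠ 0 := by exact_mod_cast hq
  have hpos : (0 : ℚ) ≤ ((q : ℚ) ^ m)⁻¹ := inv_nonneg.2 (pow_nonneg (Nat.cast_nonneg q) m)
  unfold ampl
  rw [show ((q : ℚ) ^ m)⁻¹ * (4 * max 0 ((q : ℚ) ^ (k : ℤ) - (q : ℚ) ^ ((k : ℤ) - B)) / ((q : ℚ) - 1)) =
      4 * (((q : ℚ) ^ m)⁻¹ * max 0 ((q : ℚ) ^ (k : ℤ) - (q : ℚ) ^ ((k : ℤ) - B))) / ((q : ℚ) - 1) by ring,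
    mul_max_of_nonneg _ _ hpos, mul_zero, mul_sub, ← zpow_natCast (q : ℚ) m, ← zpow_neg, ← zpow_add₀ hq0, ← zpow_add₀ hq0, hj]
  congr 3
  ring

/-! ## §2 HEAD: the row-(1) reduction in depth currency -/

/-- **THE ROW-(1) REDUCTION IN DEPTH CURRENCY.**  Same frame as ★ p855299 `rowOne_of_hSideIdentity` (outer binders of ★ №2c-R `HSideAnchorRowsS` VERBATIM, any finite family
`(ψ, coef)`); the H-side hypothesis now reads `Σ_s coef_s·Φ^st(γ_H, ψ_s) = C · 4·(q_w^{j} − q_w^{shift d t_E − [τ d]_{t≠0}})⁺∕(q_w − 1)`, `j = (n₃ + 2 − d)∕2` — the depth `n₃` of `g`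
and the place datum only.  Proof: `i = 2` (★ slot lemma on the row's Δ-antecedent), `k − m = j` and `j − B′ = shift d t_E − [τ d]` by `omega` from `2k + d = Σ n + 2`, `2m = n₁ + n₂`
(★ «T∕P»), `2B = n₃ − d + 2 − 2·shift d t_E`; `q_v = q_w` (★, ramified); §1; then ★ p855299. [cite: Rogawski1990, §4.9 Prop. 4.9.1 (a) p. 55; Lemma 4.9.3 (4.9.2) p. 56]
[cite: LabesseLanglands1979, §2 (2.2)] [cite: NeukirchANT1999, Ch. II §4 Prop. (4.3)] -/
theorem rowOne_of_hSideIdentity_depth (shift : ℕ → ℕ → ℤ) (N₀ : ℕ → ℕ) (τ : ℕ → ℤ) (t : ℕ)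
    (L : Type) [Field L] [NumberField L] [IsCMField L]
      {v : HeightOneSpectrum (𝓞 ↥(maximalRealSubfield L))} (w : UnitaryGroup.PlacesOver L v)
      (hw : IsCMField.complexConj L • w.1 = w.1) (_he : v.asIdeal.ramificationIdx' w.1.asIdeal ≠ 1)
      (_h2 : ¬ IsUnit (2 : 𝒪[w.1.adicCompletion L]))
      (ϖ : (w.1.adicCompletion L)) (_hϖ : Valued.v ϖ = WithZero.exp (-1 : ℤ)) (d tE : ℕ) (_hD : IsRamifiedQuadraticDatum (galAdicCompletionMap (L := L) (IsCMField.complexConj L) hw) ϖ d tE)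
      [Fintype (Valued.ResidueField (w.1.adicCompletion L))] (δ : (w.1.adicCompletion L)) (_hδ : (galAdicCompletionMap (L := L) (IsCMField.complexConj L) hw) δ = -δ) (_hδ0 : δ ≠ 0)
      (μ : HeckeCharacter L) (_hμu : μ.IsUnitary)
      (_hμω : ∀ x : ideleGroup ↥(maximalRealSubfield L), μ (AdeleRing.ideleBaseChange ↥(maximalRealSubfield L) L x) = quadraticHeckeCharCM L x)
      [MeasurableSpace ((UnitaryGroup.cmDatum L 3 (Matrix.of fun i j : Fin 3 => if i.val + j.val + 1 = 3 then (1 : L) else 0)).Local v)] [BorelSpace ((UnitaryGroup.cmDatum L 3 (Matrix.of fun i j : Fin 3 => if i.val + j.val + 1 = 3 then (1 : L) else 0)).Local v)]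
      [∀ γ : ((UnitaryGroup.cmDatum L 3 (Matrix.of fun i j : Fin 3 => if i.val + j.val + 1 = 3 then (1 : L) else 0)).Local v), MeasurableSpace (((UnitaryGroup.cmDatum L 3 (Matrix.of fun i j : Fin 3 => if i.val + j.val + 1 = 3 then (1 : L) else 0)).Local v) ⧸ Subgroup.centralizer ({γ} : Set ((UnitaryGroup.cmDatum L 3 (Matrix.of fun i j : Fin 3 => if i.val + j.val + 1 = 3 then (1 : L) else 0)).Local v)))]
      [∀ γ : ((UnitaryGroup.cmDatum L 3 (Matrix.of fun i j : Fin 3 => if i.val + j.val + 1 = 3 then (1 : L) else 0)).Local v), BorelSpace (((UnitaryGroup.cmDatum L 3 (Matrix.of fun i j : Fin 3 => if i.val + j.val + 1 = 3 then (1 : L) else 0)).Local v) ⧸ Subgroup.centralizer ({γ} : Set ((UnitaryGroup.cmDatum L 3 (Matrix.of fun i j : Fin 3 => if i.val + j.val + 1 = 3 then (1 : L) else 0)).Local v)))]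
      [MeasurableSpace ((UnitaryGroup.cmDatum L 2 (Matrix.of fun i j : Fin 2 => if i.val + j.val + 1 = 2 then (1 : L) else 0)).Local v × (UnitaryGroup.cmDatum L 1 (Matrix.of fun i j : Fin 1 => if i.val + j.val + 1 = 1 then (1 : L) else 0)).Local v)] [BorelSpace ((UnitaryGroup.cmDatum L 2 (Matrix.of fun i j : Fin 2 => if i.val + j.val + 1 = 2 then (1 : L) else 0)).Local v × (UnitaryGroup.cmDatum L 1 (Matrix.of fun i j : Fin 1 => if i.val + j.val + 1 = 1 then (1 : L) else 0)).Local v)]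
      [∀ a : ((UnitaryGroup.cmDatum L 2 (Matrix.of fun i j : Fin 2 => if i.val + j.val + 1 = 2 then (1 : L) else 0)).Local v × (UnitaryGroup.cmDatum L 1 (Matrix.of fun i j : Fin 1 => if i.val + j.val + 1 = 1 then (1 : L) else 0)).Local v), MeasurableSpace (((UnitaryGroup.cmDatum L 2 (Matrix.of fun i j : Fin 2 => if i.val + j.val + 1 = 2 then (1 : L) else 0)).Local v × (UnitaryGroup.cmDatum L 1 (Matrix.of fun i j : Fin 1 => if i.val + j.val + 1 = 1 then (1 : L) else 0)).Local v) ⧸ Subgroup.centralizer ({a} : Set ((UnitaryGroup.cmDatum L 2 (Matrix.of fun i j : Fin 2 => if i.val + j.val + 1 = 2 then (1 : L) else 0)).Local v × (UnitaryGroup.cmDatum L 1 (Matrix.of fun i j : Fin 1 => if i.val + j.val + 1 = 1 then (1 : L) else 0)).Local v)))]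
      [∀ a : ((UnitaryGroup.cmDatum L 2 (Matrix.of fun i j : Fin 2 => if i.val + j.val + 1 = 2 then (1 : L) else 0)).Local v × (UnitaryGroup.cmDatum L 1 (Matrix.of fun i j : Fin 1 => if i.val + j.val + 1 = 1 then (1 : L) else 0)).Local v), BorelSpace (((UnitaryGroup.cmDatum L 2 (Matrix.of fun i j : Fin 2 => if i.val + j.val + 1 = 2 then (1 : L) else 0)).Local v × (UnitaryGroup.cmDatum L 1 (Matrix.of fun i j : Fin 1 => if i.val + j.val + 1 = 1 then (1 : L) else 0)).Local v) ⧸ Subgroup.centralizer ({a} : Set ((UnitaryGroup.cmDatum L 2 (Matrix.of fun i j : Fin 2 => if i.val + j.val + 1 = 2 then (1 : L) else 0)).Local v × (UnitaryGroup.cmDatum L 1 (Matrix.of fun i j : Fin 1 => if i.val + j.val + 1 = 1 then (1 : L) else 0)).Local v)))]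
      (νH : Measure ((UnitaryGroup.cmDatum L 2 (Matrix.of fun i j : Fin 2 => if i.val + j.val + 1 = 2 then (1 : L) else 0)).Local v × (UnitaryGroup.cmDatum L 1 (Matrix.of fun i j : Fin 1 => if i.val + j.val + 1 = 1 then (1 : L) else 0)).Local v)) [νH.IsHaarMeasure] [νH.IsMulRightInvariant]
      (νG₃ : Measure ((UnitaryGroup.cmDatum L 3 (Matrix.of fun i j : Fin 3 => if i.val + j.val + 1 = 3 then (1 : L) else 0)).Local v)) [νG₃.IsHaarMeasure] [νG₃.IsMulRightInvariant]
      (mH : OrbitalMeasureFamily ((UnitaryGroup.cmDatum L 2 (Matrix.of fun i j : Fin 2 => if i.val + j.val + 1 = 2 then (1 : L) else 0)).Local v × (UnitaryGroup.cmDatum L 1 (Matrix.of fun i j : Fin 1 => if i.val + j.val + 1 = 1 then (1 : L) else 0)).Local v)) (mG₃ : OrbitalMeasureFamily ((UnitaryGroup.cmDatum L 3 (Matrix.of fun i j : Fin 3 => if i.val + j.val + 1 = 3 then (1 : L) else 0)).Local v))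
      (_hmH : mH.IsCanonical (IsLocalGRegular L v) νH) (_hmG : mG₃.IsCanonical (fun γ => IsRegularElt (γ.val : GL (Fin 3) (UnitaryGroup.LocalRing L v))) νG₃)
      (N : Submodule (Valued.integer (w.1.adicCompletion L)) (Fin 3 → (w.1.adicCompletion L))) (_hN : IsVertexLattice (galAdicCompletionMap (L := L) (IsCMField.complexConj L) hw) ϖ ((StdForm.antidiagonal 3).over (w.1.adicCompletion L)) t N)
      (Kt : Subgroup ((UnitaryGroup.cmDatum L 3 (Matrix.of fun i j : Fin 3 => if i.val + j.val + 1 = 3 then (1 : L) else 0)).Local v)) (_hKt : ∀ u : ((UnitaryGroup.cmDatum L 3 (Matrix.of fun i j : Fin 3 => if i.val + j.val + 1 = 3 then (1 : L) else 0)).Local v), u ∈ Kt ↔ mapGL ((localNonsplitEquiv (IsCMField.complexConj L) (Matrix.of fun i j : Fin 3 => if i.val + j.val + 1 = 3 then (1 : L) else 0) (IsCMField.complexConj_ne_one L) w hw u :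
              ↥(unitaryGroupOfForm (galAdicCompletionMap (L := L) (IsCMField.complexConj L) hw) (placeForm (Matrix.of fun i j : Fin 3 => if i.val + j.val + 1 = 3 then (1 : L) else 0) w.1))) : GL (Fin 3) (w.1.adicCompletion L)) N = N)
      (C : ℂ)
      {r : ℕ} (ψ : Fin r → ((UnitaryGroup.cmDatum L 2 (Matrix.of fun i j : Fin 2 => if i.val + j.val + 1 = 2 then (1 : L) else 0)).Local v × (UnitaryGroup.cmDatum L 1 (Matrix.of fun i j : Fin 1 => if i.val + j.val + 1 = 1 then (1 : L) else 0)).Local v) → ℂ) (coef : Fin r → ℂ)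
      (hH :
        (∃ V ∈ 𝓝 (1 : ((UnitaryGroup.cmDatum L 2 (Matrix.of fun i j : Fin 2 => if i.val + j.val + 1 = 2 then (1 : L) else 0)).Local v × (UnitaryGroup.cmDatum L 1 (Matrix.of fun i j : Fin 1 => if i.val + j.val + 1 = 1 then (1 : L) else 0)).Local v)), ∀ γH ∈ V, IsLocalGRegular L v γH →
          ∀ (f : Fin 4 → Fin 3 → (Fin 3 → (w.1.adicCompletion L))) (_hf : IsFourFrameFamily (galAdicCompletionMap (L := L) (IsCMField.complexConj L) hw) f)
        (a b z : (w.1.adicCompletion L)) (_ha : a * (galAdicCompletionMap (L := L) (IsCMField.complexConj L) hw) a = 1) (_hb : b * (galAdicCompletionMap (L := L) (IsCMField.complexConj L) hw) b = 1) (_hz : z * (galAdicCompletionMap (L := L) (IsCMField.complexConj L) hw) z = 1)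
        (_hzγ : z = finGammaTwo L v γH w) (_hra : ((((γH).1.val : GL (Fin 2) (UnitaryGroup.LocalRing L v)).val.map (Pi.evalRingHom (fun w' : UnitaryGroup.PlacesOver L v => w'.1.adicCompletion L) w))).charpoly.IsRoot (z * (a * a))) (_hrb : ((((γH).1.val : GL (Fin 2) (UnitaryGroup.LocalRing L v)).val.map (Pi.evalRingHom (fun w' : UnitaryGroup.PlacesOver L v => w'.1.adicCompletion L) w))).charpoly.IsRoot (z * (b * b)))
        (_ha1 : Valued.v (a - 1) < Valued.v (2 : (w.1.adicCompletion L))) (_hb1 : Valued.v (b - 1) < Valued.v (2 : (w.1.adicCompletion L)))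
        (n₁ n₂ n₃ : ℕ) (_hE : IsElementDatum (galAdicCompletionMap (L := L) (IsCMField.complexConj L) hw) ϖ (N₀ d) (a * a) (b * b) n₁ n₂ n₃)
        (k : ℕ) (_hk : 2 * k + d = n₁ + n₂ + n₃ + 2)
        (Γ : Fin 4 → GL (Fin 3) (w.1.adicCompletion L)) (_hΓ : ∀ b', (Γ b' : Matrix (Fin 3) (Fin 3) (w.1.adicCompletion L)) = frameElt (galAdicCompletionMap (L := L) (IsCMField.complexConj L) hw) f b' (a * a) (b * b))
        (tb : Fin 4 → ((UnitaryGroup.cmDatum L 3 (Matrix.of fun i j : Fin 3 => if i.val + j.val + 1 = 3 then (1 : L) else 0)).Local v)) (_htb : ∀ b', ((((localNonsplitEquiv (IsCMField.complexConj L) (Matrix.of fun i j : Fin 3 => if i.val + j.val + 1 = 3 then (1 : L) else 0) (IsCMField.complexConj_ne_one L) w hw (tb b') :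
              ↥(unitaryGroupOfForm (galAdicCompletionMap (L := L) (IsCMField.complexConj L) hw) (placeForm (Matrix.of fun i j : Fin 3 => if i.val + j.val + 1 = 3 then (1 : L) else 0) w.1))) : GL (Fin 3) (w.1.adicCompletion L)) : Matrix (Fin 3) (Fin 3) (w.1.adicCompletion L))) = z • (Γ b' : Matrix (Fin 3) (Fin 3) (w.1.adicCompletion L)))
            (i : Fin 3) (B : ℤ), 2 * B = ((![n₁, n₂, n₃] : Fin 3 → ℕ) i : ℤ) - d + 2 - 2 * shift d tE →
            (∀ t' : ((UnitaryGroup.cmDatum L 3 (Matrix.of fun i j : Fin 3 => if i.val + j.val + 1 = 3 then (1 : L) else 0)).Local v), IsLocalNormPair L (Matrix.of fun i j : Fin 3 => if i.val + j.val + 1 = 3 then (1 : L) else 0) v γH t' ↔ ∃ b', ConjClasses.mk t' = ConjClasses.mk (tb b')) →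
            (∀ b' : Fin 4, ((finExplicitCollection L (Matrix.of fun i j : Fin 3 => if i.val + j.val + 1 = 3 then (1 : L) else 0) μ (finExplicitDelta_conj_left_all L (Matrix.of fun i j : Fin 3 => if i.val + j.val + 1 = 3 then (1 : L) else 0) μ) (finExplicitDelta_conj_right_all L (Matrix.of fun i j : Fin 3 => if i.val + j.val + 1 = 3 then (1 : L) else 0) μ)) v).Δ γH (tb b') = ((finExplicitCollection L (Matrix.of fun i j : Fin 3 => if i.val + j.val + 1 = 3 then (1 : L) else 0) μ (finExplicitDelta_conj_left_all L (Matrix.of fun i j : Fin 3 => if i.val + j.val + 1 = 3 then (1 : L) else 0) μ) (finExplicitDelta_conj_right_all L (Matrix.of fun i j : Fin 3 => if i.val + j.val + 1 = 3 then (1 : L) else 0) μ)) v).Δ γH (tb 0) * (kappaChar i b' : ℂ)) →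
            ∑ s, coef s * stableOrbitalIntegralRel (IsLocalStablyConjH L v) mH (ψ s) γH =
              C * (((4 : ℚ) * max 0 ((Fintype.card (Valued.ResidueField (w.1.adicCompletion L)) : ℚ) ^ (((n₃ : ℤ) + 2 - d) / 2) - (Fintype.card (Valued.ResidueField (w.1.adicCompletion L)) : ℚ) ^ (shift d tE - (if t = 0 then 0 else τ d))) / ((Fintype.card (Valued.ResidueField (w.1.adicCompletion L)) : ℚ) - 1) : ℚ) : ℂ))) :
        (∃ V ∈ 𝓝 (1 : ((UnitaryGroup.cmDatum L 2 (Matrix.of fun i j : Fin 2 => if i.val + j.val + 1 = 2 then (1 : L) else 0)).Local v × (UnitaryGroup.cmDatum L 1 (Matrix.of fun i j : Fin 1 => if i.val + j.val + 1 = 1 then (1 : L) else 0)).Local v)), ∀ γH ∈ V, IsLocalGRegular L v γH →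
          ∀ (f : Fin 4 → Fin 3 → (Fin 3 → (w.1.adicCompletion L))) (_hf : IsFourFrameFamily (galAdicCompletionMap (L := L) (IsCMField.complexConj L) hw) f)
        (a b z : (w.1.adicCompletion L)) (_ha : a * (galAdicCompletionMap (L := L) (IsCMField.complexConj L) hw) a = 1) (_hb : b * (galAdicCompletionMap (L := L) (IsCMField.complexConj L) hw) b = 1) (_hz : z * (galAdicCompletionMap (L := L) (IsCMField.complexConj L) hw) z = 1)
        (_hzγ : z = finGammaTwo L v γH w) (_hra : ((((γH).1.val : GL (Fin 2) (UnitaryGroup.LocalRing L v)).val.map (Pi.evalRingHom (fun w' : UnitaryGroup.PlacesOver L v => w'.1.adicCompletion L) w))).charpoly.IsRoot (z * (a * a))) (_hrb : ((((γH).1.val : GL (Fin 2) (UnitaryGroup.LocalRing L v)).val.map (Pi.evalRingHom (fun w' : UnitaryGroup.PlacesOver L v => w'.1.adicCompletion L) w))).charpoly.IsRoot (z * (b * b)))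
        (_ha1 : Valued.v (a - 1) < Valued.v (2 : (w.1.adicCompletion L))) (_hb1 : Valued.v (b - 1) < Valued.v (2 : (w.1.adicCompletion L)))
        (n₁ n₂ n₃ : ℕ) (_hE : IsElementDatum (galAdicCompletionMap (L := L) (IsCMField.complexConj L) hw) ϖ (N₀ d) (a * a) (b * b) n₁ n₂ n₃)
        (k : ℕ) (_hk : 2 * k + d = n₁ + n₂ + n₃ + 2)
        (Γ : Fin 4 → GL (Fin 3) (w.1.adicCompletion L)) (_hΓ : ∀ b', (Γ b' : Matrix (Fin 3) (Fin 3) (w.1.adicCompletion L)) = frameElt (galAdicCompletionMap (L := L) (IsCMField.complexConj L) hw) f b' (a * a) (b * b))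
        (tb : Fin 4 → ((UnitaryGroup.cmDatum L 3 (Matrix.of fun i j : Fin 3 => if i.val + j.val + 1 = 3 then (1 : L) else 0)).Local v)) (_htb : ∀ b', ((((localNonsplitEquiv (IsCMField.complexConj L) (Matrix.of fun i j : Fin 3 => if i.val + j.val + 1 = 3 then (1 : L) else 0) (IsCMField.complexConj_ne_one L) w hw (tb b') :
              ↥(unitaryGroupOfForm (galAdicCompletionMap (L := L) (IsCMField.complexConj L) hw) (placeForm (Matrix.of fun i j : Fin 3 => if i.val + j.val + 1 = 3 then (1 : L) else 0) w.1))) : GL (Fin 3) (w.1.adicCompletion L)) : Matrix (Fin 3) (Fin 3) (w.1.adicCompletion L))) = z • (Γ b' : Matrix (Fin 3) (Fin 3) (w.1.adicCompletion L)))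
            (i : Fin 3) (B : ℤ), 2 * B = ((![n₁, n₂, n₃] : Fin 3 → ℕ) i : ℤ) - d + 2 - 2 * shift d tE →
            (∀ t' : ((UnitaryGroup.cmDatum L 3 (Matrix.of fun i j : Fin 3 => if i.val + j.val + 1 = 3 then (1 : L) else 0)).Local v), IsLocalNormPair L (Matrix.of fun i j : Fin 3 => if i.val + j.val + 1 = 3 then (1 : L) else 0) v γH t' ↔ ∃ b', ConjClasses.mk t' = ConjClasses.mk (tb b')) →
            (∀ b' : Fin 4, ((finExplicitCollection L (Matrix.of fun i j : Fin 3 => if i.val + j.val + 1 = 3 then (1 : L) else 0) μ (finExplicitDelta_conj_left_all L (Matrix.of fun i j : Fin 3 => if i.val + j.val + 1 = 3 then (1 : L) else 0) μ) (finExplicitDelta_conj_right_all L (Matrix.of fun i j : Fin 3 => if i.val + j.val + 1 = 3 then (1 : L) else 0) μ)) v).Δ γH (tb b') = ((finExplicitCollection L (Matrix.of fun i j : Fin 3 => if i.val + j.val + 1 = 3 then (1 : L) else 0) μ (finExplicitDelta_conj_left_all L (Matrix.of fun i j : Fin 3 => if i.val + j.val + 1 = 3 then (1 : L) else 0) μ)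 (finExplicitDelta_conj_right_all L (Matrix.of fun i j : Fin 3 => if i.val + j.val + 1 = 3 then (1 : L) else 0) μ)) v).Δ γH (tb 0) * (kappaChar i b' : ℂ)) →
            ∑ s, coef s * stableOrbitalIntegralRel (IsLocalStablyConjH L v) mH (ψ s) γH =
              ((finExplicitCollection L (Matrix.of fun i j : Fin 3 => if i.val + j.val + 1 = 3 then (1 : L) else 0) μ (finExplicitDelta_conj_left_all L (Matrix.of fun i j : Fin 3 => if i.val + j.val + 1 = 3 then (1 : L) else 0) μ) (finExplicitDelta_conj_right_all L (Matrix.of fun i j : Fin 3 => if i.val + j.val + 1 = 3 then (1 : L) else 0) μ)) v).Δ γH (tb 0) * C *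
                (((baseSign (galAdicCompletionMap (L := L) (IsCMField.complexConj L) hw) i * normSign (galAdicCompletionMap (L := L) (IsCMField.complexConj L) hw) (fPartProd δ ![a, b, 1] i) : ℤ) : ℂ) *
                  ((ampl (Fintype.card (Valued.ResidueField (w.1.adicCompletion L))) k (if t = 0 then B else B + τ d) : ℚ) : ℂ))) := by
  classical
  refine rowOne_of_hSideIdentity shift N₀ τ t L w hw _he _h2 ϖ _hϖ d tE _hD δ _hδ _hδ0 μ _hμu _hμω νH νG₃ mH mG₃ _hmH _hmG N _hN Kt _hKt C ψ coef ?_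
  obtain ⟨V, hV, h⟩ := hH
  refine ⟨V, hV, ?_⟩
  intro γH hγ hreg f hf a b z ha hb hz hzγ hra hrb ha1 hb1 n₁ n₂ n₃ hE k hk Γ hΓ tb htb i B hB hnorm hrel
  have hab : a * a ≠ b * b := hE.2.2.1
  have hn₁ : Valued.v (b * b - 1) = Valued.v ϖ ^ n₁ := hE.2.2.2.2.2.1
  have hn₂ : Valued.v (a * a - 1) = Valued.v ϖ ^ n₂ := hE.2.2.2.2.2.2.1
  obtain ⟨hev, -⟩ := valued_rootProduct_eq_toPlace_pow_half_of_datum L v w hw _he _hD _hδ _hδ0 ha hb hz hn₂ hn₁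
  -- the slot is `i = 2`
  have hC : ∀ b', IsLocalNormPair L (Matrix.of fun i j : Fin 3 => if i.val + j.val + 1 = 3 then (1 : L) else 0) v γH (tb b') :=
    fun b' => (hnorm (tb b')).2 ⟨b', rfl⟩
  have hu := isUnit_eval_finCharpolyTwo_of_isLocalGRegular L v γH hreg
  have hD0 : ((finExplicitCollection L (Matrix.of fun i j : Fin 3 => if i.val + j.val + 1 = 3 then (1 : L) else 0) μ
      (finExplicitDelta_conj_left_all L (Matrix.of fun i j : Fin 3 => if i.val + j.val + 1 = 3 then (1 : L) else 0) μ)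
      (finExplicitDelta_conj_right_all L (Matrix.of fun i j : Fin 3 => if i.val + j.val + 1 = 3 then (1 : L) else 0) μ)) v).Δ γH (tb 0) ≠ 0 := by
    rw [finExplicitCollection_Δ]
    exact finExplicitDelta_ne_zero_of_isUnit L v _ γH (tb 0) μ (hC 0) hu
  have hi : i = 2 := by
    refine slot_eq_two_of_kappaChar_eq hD0 fun b' => ?_
    rw [← hrel b']
    exact F0P3cDyRamTransferFactorTypeOne.delta_frame_eq_mul_kappaChar L w hw μ γH hreg hf hzγ hΓ htb hC b'
  subst hi
  have hB' : 2 * B = (n₃ : ℤ) - d + 2 - 2 * shift d tE := by simpa using hB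
  -- the exponent bookkeeping (`e = (n₁+n₂)/2`, `2e = n₁ + n₂`, `2k + d = n₁ + n₂ + n₃ + 2`)
  have hev' : 2 * (((n₁ + n₂) / 2 : ℕ) : ℤ) = (n₁ : ℤ) + n₂ := by exact_mod_cast hev
  have hk' : 2 * (k : ℤ) + d = (n₁ : ℤ) + n₂ + n₃ + 2 := by exact_mod_cast hk
  have h2j : 2 * (((n₃ : ℤ) + 2 - d) / 2) = (n₃ : ℤ) + 2 - d := by omega
  have hj : ((n₃ : ℤ) + 2 - d) / 2 = (k : ℤ) - ((n₁ + n₂) / 2 : ℕ) := by omega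
  have hBj : B = ((n₃ : ℤ) + 2 - d) / 2 - shift d tE := by omega
  have hjB : shift d tE - (if t = 0 then 0 else τ d) = ((n₃ : ℤ) + 2 - d) / 2 - (if t = 0 then B else B + τ d) := by
    split_ifs <;> omega
  -- `q_v = q_w` at the ramified place (`Valued` presentation), and the residue field is non-empty
  have hq : Fintype.card (Valued.ResidueField (w.1.adicCompletion L)) = Nat.card (𝓞 ↥(maximalRealSubfield L) ⧸ v.asIdeal) := by
    rw [← Nat.card_eq_fintype_card]; exact natCard_valuedResidueField_eq_of_ramified_CM L v w hw _he
  have hq0 : Fintype.card (Valued.ResidueField (w.1.adicCompletion L)) ≠ 0 := Fintype.card_ne_zero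
  have hA := inv_pow_mul_ampl_eq (Fintype.card (Valued.ResidueField (w.1.adicCompletion L))) hq0 ((n₁ + n₂) / 2) k
    (if t = 0 then B else B + τ d) (((n₃ : ℤ) + 2 - d) / 2) hj
  rw [h γH hγ hreg f hf a b z ha hb hz hzγ hra hrb ha1 hb1 n₁ n₂ n₃ hE k hk Γ hΓ tb htb 2 B hB hnorm hrel, hjB, ← hA, ← hq]
  push_cast
  ring

end Summit.HodgeConjecture.HodgeConjecture.Cruxes.H413.F0P3cDyRamRowOneReductionDepth

end
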